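import Literature.AlgebraicGeometry.Resolution.ArithmeticalThreefoldsLocalStep
import Literature.AlgebraicGeometry.Resolution.LocalModels
import Literature.AlgebraicGeometry.Resolution.ResidueAlgebraicTower
import Literature.AlgebraicGeometry.Resolution.ExcellentRingsEssFiniteType
import HarnessLib

/-!
# The degree-`p` step of Cossart–Piltant's tower, with its bookkeeping (proof of Prop. 4.10)

Topic: `Literature/AlgebraicGeometry/Resolution`. PROOF side of `CossartPiltant2019ReductionP`
(`ArithmeticalThreefoldsLocal.lean`), continued from `ArithmeticalThreefoldsLocalStep.lean` and
`ArithmeticalThreefoldsReduction.lean`: the latter reduces the named fact to a climbing statement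
over the Cohen subring `S`, whose degree-`p` steps (the purely inseparable part of `K | F` by
Thm. 1.5 (i); the `p`-part `Kʳ | Fʳ` of the ramification tower by Thm. 1.5 (ii) — Cossart–Piltant
2019, proof of Prop. 4.10, arXiv v1 p. 54) consist in re-applying the local theorem over the
local ring `T_P` of the model obtained so far. This file packages ONE such step with all the
bookkeeping that makes it iterable:

* `CossartPiltant2019Local.exists_model_step` — from a model `T = S[t] ⊆ K` with `Frac T = K`,
  contained in `O_L` and regular at the centre, and a degree-`p` step `L = K(x)` in case (i) or
  (ii) (rendered on `T`: `h ∈ T[X]` monic of degree `p` irreducible over `K`; in case (ii)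
  `b · σ(x) = g(x)` with `g ∈ T[X]`, `b ∈ T ∖ P` for every `K`-automorphism `σ` of `L`), a model
  `T' = S[t'] ⊆ O_L` of `L` with `Frac T' = L`, regular at the centre;
* `exists_model_base` — the base of the tower, `(LU v₀)`: the model `S[∅] ⊆ F = Frac S` in the
  same shape ("`(LU v₀)` holds by construction since `S` is regular").

The hypotheses of the local theorem over `T_P` are discharged here: excellence
(`isExcellentRing_localization_atPrime`, resting on `Stacks07PV_holds`), dimension three (the
dimension formula `ringKrullDim_localization_eq_of_isUniversallyCatenaryRing` with the centre
and residue bookkeeping of `LocalModels.lean`, residue algebraicity being moved from `O_L` down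
to `O_L ∩ K`), residue characteristic `p` (`S → T_P` is local), `Frac T_P = K` (Mathlib), the
`σ`-stability of `T_P[x]`; and the conclusion is re-packaged as a model `S[t']` with
`Frac S[t'] = K(x) = L`.

Everything is PROVED; no named facts are introduced (the local theorem enters as the hypothesis
`hloc : CossartPiltant2019Local`).

## Sources

* V. Cossart, O. Piltant, J. Algebra 529 (2019) 268–535 = arXiv:1412.0868: journal Thm. 1.5 and
  proof of Prop. 4.10 (arXiv v1: Thm. 1.4 p. 4; Prop. 4.8, proof pp. 53–54). [CossartPiltant2019]
-/

noncomputable section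

open IsLocalRing Polynomial

namespace Literature.AlgebraicGeometry.Resolution

universe u

/-- Two descriptions `R₁ = R₂` of the same subalgebra, with centres both cut out by `v < 1`,
have the same local ring at the centre (copy of the bookkeeping lemma of
`ArithmeticalThreefoldsReduction.lean`, to keep the imports light). [folklore] -/
private theorem isRegularLocalRing_localization_iff_of_subalgebra_eq' {S L : Type u} [CommRing S]
    [Field L] [Algebra S L] (O : ValuationSubring L) {R₁ R₂ : Subalgebra S L} (h : R₁ = R₂)
    (P₁ : Ideal R₁) [P₁.IsPrime] (hP₁ : ∀ x : R₁, x ∈ P₁ ↔ O.valuation (x : L) < 1)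
    (P₂ : Ideal R₂) [P₂.IsPrime] (hP₂ : ∀ x : R₂, x ∈ P₂ ↔ O.valuation (x : L) < 1) :
    IsRegularLocalRing (Localization.AtPrime P₁) ↔ IsRegularLocalRing (Localization.AtPrime P₂) := by
  subst h
  have hP : P₁ = P₂ := by ext x; rw [hP₁, hP₂]
  subst hP
  exact Iff.rfl

/-- **The degree-`p` step with its bookkeeping** (Cossart–Piltant 2019, proof of Prop. 4.10,
arXiv v1 p. 54: the application of Thm. 1.5 (i)/(ii) over the local ring of the previous local
uniformization, together with everything needed to ITERATE it along a tower of degree-`p`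
extensions). Data: an excellent local domain `S` of dimension three and residue characteristic
`p` (the Cohen subring; excellence gives universal catenarity and Noetherianity); a tower of
fields `S → K → L` with `K` algebraic over `S`; a valuation ring `O_L` of `L` containing and
dominating `S`, with residue field algebraic over `S/𝔪_S` (elementary rendering); a model
`T = S[t] ⊆ K` with `Frac T = K`, contained in `O_L`, whose local ring `T_P` at the centre
`P = {v < 1}` is regular; and a degree-`p` step `L = K(x)`, `x` a root of a monic `h ∈ T[X]`
of degree `p` irreducible over `K`, with either (i) `char K = p` and `h = X^p + a`, or (ii)
`|Aut_K L| = p` and, for every `σ`, `b · σ(x) = g(x)` for some `g ∈ T[X]`, `b ∈ T ∖ P`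
(so that `T_P[x]` is `σ`-stable). Conclusion: a model `T' = S[t'] ⊆ O_L` of `L` with
`Frac T' = L` which is regular at the centre of `O_L` — the same data one level up.
Bookkeeping PROVED here: `T_P` is excellent (`isExcellentRing_localization_atPrime`), of
dimension three (dimension formula, `DimensionFormula.lean`/`LocalModels.lean`, using residue
algebraicity moved down to `K`), of residue characteristic `p` (domination), `Frac T_P = K`;
the local theorem is consumed through
`CossartPiltant2019Local.exists_adjoin_map_union_isRegularLocalRing`.
[cite: CossartPiltant2019, proof of Prop. 4.10 (arXiv v1: Prop. 4.8, p. 54) with Thm. 1.5 (arXiv v1: Thm. 1.4)] -/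
theorem CossartPiltant2019Local.exists_model_step (hloc : CossartPiltant2019Local.{u}) (p : ℕ)
    (hp : p.Prime) {S K L : Type u} [CommRing S] [IsDomain S] [IsLocalRing S] [Field K] [Field L]
    [Algebra S K] [Algebra K L] [Algebra S L] [IsScalarTower S K L] [FaithfulSMul S K]
    [Algebra.IsAlgebraic S K]
    (hS : IsExcellentRing S) (hSdim : ringKrullDim S = 3) (hSchar : CharP (ResidueField S) p)
    (OL : ValuationSubring L) (hSO : ∀ s : S, algebraMap S L s ∈ OL)
    (hdom : ∀ s ∈ maximalIdeal S, OL.valuation (algebraMap S L s) < 1)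
    (hres : ∀ y : OL, ∃ q : S[X], (∃ i, q.coeff i ∉ maximalIdeal S) ∧
      OL.valuation (q.eval₂ (algebraMap S L) y) < 1)
    (t : Finset K) (hTO : ∀ z : Algebra.adjoin S (t : Set K), algebraMap K L z ∈ OL)
    (hfrac : IsFractionRing (Algebra.adjoin S (t : Set K)) K)
    (P : Ideal (Algebra.adjoin S (t : Set K))) [P.IsPrime]
    (hP : ∀ z : Algebra.adjoin S (t : Set K), z ∈ P ↔ OL.valuation (algebraMap K L z) < 1)
    (hreg : IsRegularLocalRing (Localization.AtPrime P))
    (h : (Algebra.adjoin S (t : Set K))[X]) (x : L) (hmon : h.Monic) (hdeg : h.natDegree = p)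
    (hirr : Irreducible (h.map (algebraMap (Algebra.adjoin S (t : Set K)) K)))
    (hx : aeval x (h.map (algebraMap (Algebra.adjoin S (t : Set K)) K)) = 0)
    (hgen : Algebra.adjoin K ({x} : Set L) = ⊤)
    (hcase : (CharP K p ∧ ∀ i, 0 < i → i < p → h.coeff i = 0) ∨
      (Nat.card (L ≃ₐ[K] L) = p ∧ ∀ σ : L ≃ₐ[K] L,
        ∃ (g : (Algebra.adjoin S (t : Set K))[X]) (b : Algebra.adjoin S (t : Set K)), b ∉ P ∧
          algebraMap K L b * σ x =
            aeval x (g.map (algebraMap (Algebra.adjoin S (t : Set K)) K)))) :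
    ∃ (t' : Finset L) (hTO' : (Algebra.adjoin S (t' : Set L)).toSubring ≤ OL.toSubring),
      IsFractionRing (Algebra.adjoin S (t' : Set L)) L ∧
      IsRegularLocalRing (Localization.AtPrime
        (Ideal.comap (Subring.inclusion hTO') (maximalIdeal OL))) := by
  classical
  haveI hfrac' := hfrac
  haveI : IsNoetherianRing S := hS.isUniversallyCatenaryRing.1
  -- the local ring `T_P`, realised in `K` and `L`
  let Sₚ := Localization.AtPrime P
  haveI : IsRegularLocalRing Sₚ := hreg
  haveI : IsDomain Sₚ := isDomain_of_isRegularLocalRing Sₚ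
  have hunits : ∀ y : P.primeCompl, IsUnit (algebraMap (Algebra.adjoin S (t : Set K)) K y) := fun y => by
    rw [isUnit_iff_ne_zero]
    intro h0
    apply y.2
    have : (y : (Algebra.adjoin S (t : Set K))) = 0 := Subtype.ext h0
    rw [this]
    exact P.zero_mem
  letI : Algebra Sₚ K := (IsLocalization.lift (M := P.primeCompl) hunits).toAlgebra
  haveI : IsScalarTower (Algebra.adjoin S (t : Set K)) Sₚ K :=
    IsScalarTower.of_algebraMap_eq fun a => (IsLocalization.lift_eq hunits a).symm
  haveI : IsFractionRing Sₚ K :=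
    IsFractionRing.isFractionRing_of_isDomain_of_isLocalization P.primeCompl Sₚ K
  letI : Algebra Sₚ L := ((algebraMap K L).comp (algebraMap Sₚ K)).toAlgebra
  haveI : IsScalarTower Sₚ K L := IsScalarTower.of_algebraMap_eq fun _ => rfl
  have hSSp : ∀ s : S, algebraMap S Sₚ s = algebraMap (Algebra.adjoin S (t : Set K)) Sₚ (algebraMap S (Algebra.adjoin S (t : Set K)) s) :=
    fun s => IsScalarTower.algebraMap_apply S (Algebra.adjoin S (t : Set K)) Sₚ s
  haveI : IsScalarTower S Sₚ K := IsScalarTower.of_algebraMap_eq fun s => by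
    rw [hSSp, ← IsScalarTower.algebraMap_apply (Algebra.adjoin S (t : Set K)) Sₚ K, ← IsScalarTower.algebraMap_apply S (Algebra.adjoin S (t : Set K)) K]
  -- the valuation restricted to `K`
  let OK : ValuationSubring K := OL.comap (algebraMap K L)
  have hOK : ∀ z : K, OL.valuation (algebraMap K L z) < 1 ↔ OK.valuation z < 1 := fun z =>
    valuation_algebraMap_lt_one_iff_of_comap_eq' OK OL rfl z
  have hSOK : ∀ s : S, algebraMap S K s ∈ OK := fun s => by
    change algebraMap K L (algebraMap S K s) ∈ OL
    rw [← IsScalarTower.algebraMap_apply]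
    exact hSO s
  have hdomK : ∀ s ∈ maximalIdeal S, OK.valuation (algebraMap S K s) < 1 := fun s hs => by
    rw [← hOK, ← IsScalarTower.algebraMap_apply]
    exact hdom s hs
  have hresK : ∀ y : OK, ∃ q : S[X], (∃ i, q.coeff i ∉ maximalIdeal S) ∧
      OK.valuation (q.eval₂ (algebraMap S K) y) < 1 := fun y => by
    obtain ⟨q, hq, hv⟩ := hres ⟨algebraMap K L y, y.2⟩
    refine ⟨q, hq, ?_⟩
    rw [← hOK, Polynomial.hom_eval₂, ← IsScalarTower.algebraMap_eq]
    exact hv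
  have hTOK : ∀ z : (Algebra.adjoin S (t : Set K)), (z : K) ∈ OK := fun z => hTO z
  have hPK : ∀ z : (Algebra.adjoin S (t : Set K)), z ∈ P ↔ OK.valuation (z : K) < 1 := fun z => by rw [hP, hOK]
  -- bookkeeping on `T_P`: excellent, dimension three, residue characteristic `p`
  haveI : Algebra.FiniteType S (Algebra.adjoin S (t : Set K)) := (Subalgebra.fg_iff_finiteType _).mp (Subalgebra.fg_adjoin_finset _)
  have hexc : IsExcellentRing Sₚ := isExcellentRing_localization_atPrime hS P
  haveI : FaithfulSMul S (Algebra.adjoin S (t : Set K)) := (faithfulSMul_iff_algebraMap_injective _ _).mpr fun a b hab =>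
    FaithfulSMul.algebraMap_injective S K (by
      have h1 := congrArg (fun z : (Algebra.adjoin S (t : Set K)) => (z : K)) hab
      rw [IsScalarTower.algebraMap_apply S (Algebra.adjoin S (t : Set K)) K a,
        IsScalarTower.algebraMap_apply S (Algebra.adjoin S (t : Set K)) K b]
      exact h1)
  haveI : Algebra.IsAlgebraic S (Algebra.adjoin S (t : Set K)) :=
    Algebra.IsAlgebraic.of_injective (Algebra.adjoin S (t : Set K)).val Subtype.val_injective
  haveI := liesOver_maximalIdeal_of_forall_valuation_lt_one OK hSOK hdomK (Algebra.adjoin S (t : Set K)) P hPK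
  haveI := isAlgebraic_quotient_of_forall_valuation_lt_one OK hresK (Algebra.adjoin S (t : Set K)) hTOK P hPK
  have hdim : ringKrullDim Sₚ = 3 := by
    rw [← hSdim]
    exact ringKrullDim_localization_eq_of_isUniversallyCatenaryRing hS.isUniversallyCatenaryRing P
  -- residue characteristic of `T_P`
  haveI hlocS : IsLocalHom (algebraMap S Sₚ) := by
    refine ⟨fun s hs => ?_⟩
    by_contra hns
    have hmem : s ∈ maximalIdeal S := (IsLocalRing.mem_maximalIdeal s).mpr hns
    have h1 : algebraMap S (Algebra.adjoin S (t : Set K)) s ∈ P := (hPK _).mpr (by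
      have := hdomK s hmem
      rwa [IsScalarTower.algebraMap_apply S (Algebra.adjoin S (t : Set K)) K] at this)
    have h2 : algebraMap S Sₚ s ∈ maximalIdeal Sₚ := by
      rw [hSSp]
      exact (IsLocalization.AtPrime.to_map_mem_maximal_iff Sₚ P _).mpr h1
    exact (IsLocalRing.mem_maximalIdeal _).mp h2 hs
  have hchar : CharP (ResidueField Sₚ) p :=
    (RingHom.charP_iff_charP (ResidueField.map (algebraMap S Sₚ)) p).mp hSchar
  -- the polynomial over `T_P`
  have hinjT : Function.Injective (algebraMap (Algebra.adjoin S (t : Set K)) Sₚ) :=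
    IsLocalization.injective Sₚ P.primeCompl_le_nonZeroDivisors
  let h' : Sₚ[X] := h.map (algebraMap (Algebra.adjoin S (t : Set K)) Sₚ)
  have hmon' : h'.Monic := hmon.map _
  have hdeg' : h'.natDegree = p := by
    rw [Polynomial.natDegree_map_eq_of_injective hinjT, hdeg]
  have hmap' : h'.map (algebraMap Sₚ K) = h.map (algebraMap (Algebra.adjoin S (t : Set K)) K) := by
    rw [Polynomial.map_map, ← IsScalarTower.algebraMap_eq]
  have hirr' : Irreducible (h'.map (algebraMap Sₚ K)) := by rw [hmap']; exact hirr
  have hx' : aeval x h' = 0 := by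
    rw [← Polynomial.aeval_map_algebraMap K x h', hmap']
    exact hx
  have hcase' : (CharP K p ∧ ∀ i, 0 < i → i < p → h'.coeff i = 0) ∨
      (Nat.card (L ≃ₐ[K] L) = p ∧ ∀ σ : L ≃ₐ[K] L, ∀ y ∈ Algebra.adjoin Sₚ ({x} : Set L),
        σ y ∈ Algebra.adjoin Sₚ ({x} : Set L)) := by
    rcases hcase with ⟨hc, hcoeff⟩ | ⟨hcard, hstab⟩
    · exact Or.inl ⟨hc, fun i hi hip => by
        rw [Polynomial.coeff_map, hcoeff i hi hip, map_zero]⟩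
    · refine Or.inr ⟨hcard, fun σ => ?_⟩
      obtain ⟨g, b, hb, hσ⟩ := hstab σ
      have hu : IsUnit (algebraMap (Algebra.adjoin S (t : Set K)) Sₚ b) := IsLocalization.map_units Sₚ (⟨b, hb⟩ : P.primeCompl)
      have hbL : algebraMap K L (b : K) = algebraMap Sₚ L (algebraMap (Algebra.adjoin S (t : Set K)) Sₚ b) := by
        rw [IsScalarTower.algebraMap_apply Sₚ K L, ← IsScalarTower.algebraMap_apply (Algebra.adjoin S (t : Set K)) Sₚ K]
        rfl
      have hinv : algebraMap Sₚ L (↑hu.unit⁻¹ : Sₚ) * algebraMap K L (b : K) = 1 := by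
        rw [hbL, ← map_mul, hu.val_inv_mul, map_one]
      have hg : aeval x (g.map (algebraMap (Algebra.adjoin S (t : Set K)) Sₚ)) = aeval x (g.map (algebraMap (Algebra.adjoin S (t : Set K)) K)) := by
        rw [← Polynomial.aeval_map_algebraMap K x (g.map (algebraMap (Algebra.adjoin S (t : Set K)) Sₚ)), Polynomial.map_map,
          ← IsScalarTower.algebraMap_eq]
      have hσx : σ x ∈ Algebra.adjoin Sₚ ({x} : Set L) := by
        have heq : σ x = algebraMap Sₚ L (↑hu.unit⁻¹ : Sₚ) * aeval x (g.map (algebraMap (Algebra.adjoin S (t : Set K)) Sₚ)) := by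
          rw [hg, ← hσ, ← mul_assoc, hinv, one_mul]
        rw [heq]
        exact mul_mem (Subalgebra.algebraMap_mem _ _) (Polynomial.aeval_mem_adjoin_singleton _ _)
      intro y hy
      let σ' : L →ₐ[Sₚ] L := (σ.restrictScalars Sₚ).toAlgHom
      have h1 : σ y ∈ (Algebra.adjoin Sₚ ({x} : Set L)).map σ' := Subalgebra.mem_map.mpr ⟨y, hy, rfl⟩
      rw [AlgHom.map_adjoin, Set.image_singleton] at h1
      exact (Algebra.adjoin_le (Set.singleton_subset_iff.mpr hσx)) h1
  -- the local theorem over `T_P`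
  obtain ⟨u, hu, hreg'⟩ :=
    CossartPiltant2019Local.exists_adjoin_map_union_isRegularLocalRing hloc p hp OL
      (Algebra.adjoin S (t : Set K)) hTO P hP Sₚ hexc hdim hchar h' x hmon' hdeg' hirr' hx' hgen
      hcase'
  -- the new model `S[t']`, `t' = (image of t) ∪ {x} ∪ u`
  let φ : K →ₐ[S] L := IsScalarTower.toAlgHom S K L
  set t' : Finset L := t.image (algebraMap K L) ∪ insert x u with ht'def
  have hTmap : ((Algebra.adjoin S (t : Set K)).map φ : Subalgebra S L) =
      Algebra.adjoin S ((t.image (algebraMap K L) : Finset L) : Set L) := by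
    rw [AlgHom.map_adjoin, Finset.coe_image]
    rfl
  have hset : Algebra.adjoin S ((t' : Finset L) : Set L) =
      Algebra.adjoin S ((((Algebra.adjoin S (t : Set K)).map φ : Subalgebra S L) : Set L) ∪ insert x (u : Set L)) := by
    have hcoe : ((t' : Finset L) : Set L) =
        ((t.image (algebraMap K L) : Finset L) : Set L) ∪ insert x (u : Set L) := by
      rw [ht'def, Finset.coe_union, Finset.coe_insert]
    rw [hcoe, hTmap]
    apply le_antisymm
    · apply Algebra.adjoin_le
      rintro z (hz | hz)
      · exact Algebra.subset_adjoin (Set.mem_union_left _ (Algebra.subset_adjoin hz))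
      · exact Algebra.subset_adjoin (Set.mem_union_right _ hz)
    · apply Algebra.adjoin_le
      rintro z (hz | hz)
      · exact Algebra.adjoin_mono Set.subset_union_left hz
      · exact Algebra.subset_adjoin (Set.mem_union_right _ hz)
  have hTO' : (Algebra.adjoin S ((t' : Finset L) : Set L)).toSubring ≤ OL.toSubring := by
    rw [hset]; exact hu
  have hxA' : x ∈ Algebra.adjoin S ((t' : Finset L) : Set L) :=
    Algebra.subset_adjoin (by rw [ht'def]; simp)
  have hTA' : ∀ z : (Algebra.adjoin S (t : Set K)), algebraMap K L z ∈ Algebra.adjoin S ((t' : Finset L) : Set L) := fun z => by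
    have hz : φ z ∈ ((Algebra.adjoin S (t : Set K)).map φ : Subalgebra S L) := Subalgebra.mem_map.mpr ⟨z, z.2, rfl⟩
    rw [hset]
    exact Algebra.subset_adjoin (Set.mem_union_left _ hz)
  refine ⟨t', hTO', ?_, ?_⟩
  · -- `Frac S[t'] = L = K(x)`
    have key : ∀ z : L, ∃ a b : L, a ∈ Algebra.adjoin S ((t' : Finset L) : Set L) ∧
        b ∈ Algebra.adjoin S ((t' : Finset L) : Set L) ∧ b ≠ 0 ∧ z * b = a := by
      intro z
      have hz : z ∈ Algebra.adjoin K ({x} : Set L) := by rw [hgen]; exact Algebra.mem_top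
      refine Algebra.adjoin_induction (p := fun z _ => ∃ a b : L,
        a ∈ Algebra.adjoin S ((t' : Finset L) : Set L) ∧
          b ∈ Algebra.adjoin S ((t' : Finset L) : Set L) ∧ b ≠ 0 ∧ z * b = a) ?_ ?_ ?_ ?_ hz
      · intro y hy
        rw [Set.mem_singleton_iff] at hy
        rw [hy]
        exact ⟨x, 1, hxA', one_mem _, one_ne_zero, mul_one _⟩
      · intro c
        obtain ⟨a, b, hb, rfl⟩ := IsFractionRing.div_surjective (A := (Algebra.adjoin S (t : Set K))) c
        have hb0 : algebraMap (Algebra.adjoin S (t : Set K)) K b ≠ 0 := fun h0 => nonZeroDivisors.ne_zero hb (Subtype.ext h0)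
        refine ⟨algebraMap K L (algebraMap (Algebra.adjoin S (t : Set K)) K a), algebraMap K L (algebraMap (Algebra.adjoin S (t : Set K)) K b), hTA' a,
          hTA' b, (_root_.map_ne_zero _).mpr hb0, ?_⟩
        rw [← map_mul, div_mul_cancel₀ _ hb0]
      · rintro y z - - ⟨a₁, b₁, ha₁, hb₁, h₁0, h₁⟩ ⟨a₂, b₂, ha₂, hb₂, h₂0, h₂⟩
        refine ⟨a₁ * b₂ + a₂ * b₁, b₁ * b₂, add_mem (mul_mem ha₁ hb₂) (mul_mem ha₂ hb₁),
          mul_mem hb₁ hb₂, mul_ne_zero h₁0 h₂0, ?_⟩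
        rw [← h₁, ← h₂]; ring
      · rintro y z - - ⟨a₁, b₁, ha₁, hb₁, h₁0, h₁⟩ ⟨a₂, b₂, ha₂, hb₂, h₂0, h₂⟩
        refine ⟨a₁ * a₂, b₁ * b₂, mul_mem ha₁ ha₂, mul_mem hb₁ hb₂, mul_ne_zero h₁0 h₂0, ?_⟩
        rw [← h₁, ← h₂]; ring
    haveI : FaithfulSMul (Algebra.adjoin S ((t' : Finset L) : Set L)) L :=
      (faithfulSMul_iff_algebraMap_injective _ _).mpr Subtype.val_injective
    refine IsFractionRing.of_field (Algebra.adjoin S ((t' : Finset L) : Set L)) L fun z => ?_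
    obtain ⟨a, b, ha, hb, hb0, hzb⟩ := key z
    exact ⟨⟨a, ha⟩, ⟨b, hb⟩, (eq_div_iff hb0).mpr hzb⟩
  · -- regularity at the centre
    set P₁ : Ideal (Algebra.adjoin S ((t' : Finset L) : Set L)) :=
      Ideal.comap (Subring.inclusion hTO') (maximalIdeal OL) with hP₁def
    haveI : P₁.IsPrime := Ideal.IsPrime.comap _
    set P₂ : Ideal (Algebra.adjoin S ((((Algebra.adjoin S (t : Set K)).map φ : Subalgebra S L) : Set L) ∪ insert x (u : Set L))) :=
      Ideal.comap (Subring.inclusion hu) (maximalIdeal OL) with hP₂def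
    haveI : P₂.IsPrime := Ideal.IsPrime.comap _
    refine (isRegularLocalRing_localization_iff_of_subalgebra_eq' OL hset P₁ (fun y => ?_) P₂
      (fun y => ?_)).mpr hreg'
    · rw [hP₁def, Ideal.mem_comap, ValuationSubring.valuation_lt_one_iff]; rfl
    · rw [hP₂def, Ideal.mem_comap, ValuationSubring.valuation_lt_one_iff]; rfl

/-- **The base of the tower: `(LU v₀)` for the regular local ring `S`** in the form consumed by
`CossartPiltant2019Local.exists_model_step` (Cossart–Piltant 2019, proof of Prop. 4.10: "Note that
`(LU v₀)` holds by construction since `S` is regular"): the model `S[∅] = S ⊆ F = Frac S` has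
`Frac S[∅] = F` and `S[∅]_{𝔪_{v₀} ∩ S[∅]} = S` regular, for every valuation ring of `F`
containing and dominating `S`. [cite: CossartPiltant2019, proof of Prop. 4.10 (arXiv v1: Prop. 4.8)] -/
theorem exists_model_base (S : Type u) [CommRing S] [IsDomain S] [IsRegularLocalRing S]
    (F : Type u) [Field F] [Algebra S F] [IsFractionRing S F] (OF : ValuationSubring F)
    (hSO : ∀ s : S, algebraMap S F s ∈ OF)
    (hdom : ∀ s ∈ maximalIdeal S, OF.valuation (algebraMap S F s) < 1) :
    ∃ (hTO : (Algebra.adjoin S (((∅ : Finset F) : Finset F) : Set F)).toSubring ≤ OF.toSubring),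
      IsFractionRing (Algebra.adjoin S (((∅ : Finset F) : Finset F) : Set F)) F ∧
      IsRegularLocalRing (Localization.AtPrime
        (Ideal.comap (Subring.inclusion hTO) (maximalIdeal OF))) := by
  classical
  have hmemT : ∀ y : F, y ∈ Algebra.adjoin S (((∅ : Finset F) : Finset F) : Set F) ↔
      ∃ a : S, algebraMap S F a = y := fun y => by
    rw [Finset.coe_empty, Algebra.adjoin_empty, Algebra.mem_bot, Set.mem_range]
  have hTO : (Algebra.adjoin S (((∅ : Finset F) : Finset F) : Set F)).toSubring ≤ OF.toSubring := by
    intro y hy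
    obtain ⟨a, rfl⟩ := (hmemT y).mp hy
    exact hSO a
  refine ⟨hTO, ?_, ?_⟩
  · haveI : FaithfulSMul (Algebra.adjoin S (((∅ : Finset F) : Finset F) : Set F)) F :=
      (faithfulSMul_iff_algebraMap_injective _ _).mpr Subtype.val_injective
    refine IsFractionRing.of_field _ F fun z => ?_
    obtain ⟨a, b, -, rfl⟩ := IsFractionRing.div_surjective (A := S) z
    exact ⟨⟨algebraMap S F a, (hmemT _).mpr ⟨a, rfl⟩⟩, ⟨algebraMap S F b, (hmemT _).mpr ⟨b, rfl⟩⟩,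
      rfl⟩
  · set T : Subring F := (Algebra.adjoin S (((∅ : Finset F) : Finset F) : Set F)).toSubring
      with hTdef
    set P : Ideal T := Ideal.comap (Subring.inclusion hTO) (maximalIdeal OF) with hPdef
    have hmem : ∀ a : S, algebraMap S F a ∈ T := fun a => (hmemT _).mpr ⟨a, rfl⟩
    let f : S →+* T := (algebraMap S F).codRestrict T hmem
    have hf : ∀ a, ((f a : T) : F) = algebraMap S F a := fun _ => rfl
    have hfinj : Function.Injective f := fun a b h =>
      IsFractionRing.injective S F (by rw [← hf a, ← hf b, h])
    have hfsurj : Function.Surjective f := fun y => by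
      obtain ⟨c, hc⟩ := (hmemT y).mp y.2
      exact ⟨c, Subtype.ext hc⟩
    let e : S ≃+* T := RingEquiv.ofBijective f ⟨hfinj, hfsurj⟩
    have hPmem : ∀ a : S, e a ∈ P ↔ a ∈ maximalIdeal S := by
      intro a
      rw [hPdef, Ideal.mem_comap, ValuationSubring.valuation_lt_one_iff]
      change OF.valuation (algebraMap S F a) < 1 ↔ _
      constructor
      · intro hlt
        by_contra hna
        have hu : IsUnit a := by
          by_contra hnu
          exact hna ((IsLocalRing.mem_maximalIdeal a).mpr hnu)
        obtain ⟨b, hb⟩ := hu.exists_right_inv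
        have h1 : OF.valuation (algebraMap S F a) = 1 :=
          valuation_eq_one_of_mul_eq_one OF (hSO a) (hSO b) (by rw [← map_mul, hb, map_one])
        exact (lt_irrefl _) (h1 ▸ hlt)
      · exact hdom a
    have hunits : P.primeCompl ≤ IsUnit.submonoid T := by
      intro y hy
      obtain ⟨a, rfl⟩ := e.surjective y
      have ha : a ∉ maximalIdeal S := fun h => hy ((hPmem a).mpr h)
      have hu : IsUnit a := by
        by_contra hnu
        exact ha ((IsLocalRing.mem_maximalIdeal a).mpr hnu)
      exact hu.map e
    haveI : IsLocalization P.primeCompl T := IsLocalization.self hunits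
    let g : T ≃ₐ[T] Localization.AtPrime P :=
      IsLocalization.algEquiv P.primeCompl T (Localization.AtPrime P)
    haveI : IsRegularLocalRing T := IsRegularLocalRing.of_ringEquiv e
    exact IsRegularLocalRing.of_ringEquiv g.toRingEquiv

end Literature.AlgebraicGeometry.Resolution
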